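import Summits.BirchSwinnertonDyer.BirchSwinnertonDyer.Theorems.GenusKolyvaginAtTwoGenusPrimitiveSupplyAtTwoTwistingPrime
import Summits.BirchSwinnertonDyer.BirchSwinnertonDyer.Theorems.GenusKolyvaginAtTwoGenusPrimitiveSupplyAtTwoConjugationTypeAtTwo
import HarnessLib

/-!
# Route `GenusKolyvaginAtTwo`, crux U₂ `MinimalTwinBSDTwo` (stmt-BirchSwinnertonDyer-22985), LINE 23 «twin_swap»: THE IDENTITY-PRIME DOOR, part 4a —
# the TWO-CLASS KEY LEMMA for identity twisting primes (`h ↦ ([x,h],[y,h])` is onto `E[2]²` on `Γ_{ℚ(E[2], ζ)}`)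
# (§2; the Čebotarev step §3–§4 is the sequel file `…IdentityDoorChebotarev`)

Seat `bsd-line-gk2-p2` g26 (PROVER seat 2/3, cell `bsd-f1-sign2`, LINE 23 holder), `--supports stmt-BirchSwinnertonDyer-22985` (helper; closes nothing).
THEOREMS ONLY (no definition, no named fact, no `sorry`); standard axioms; UNCONDITIONAL (Čebotarev is the tree theorem
`Automorphic.chebotarev_artinRep_holds` via `absoluteGaloisGroup.frobenius_dense`).  **BSD is NOT proved by this file; nothing is closed.**

WHY.  The identity-prime door (parts 1–3: `natCard_selmerGroup_twin_eq_one_of_identityDoor`, `bsdp_posDisc_idLocus_…`) needs, on the `Δ > 0` identity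
locus, a prime `ℓ ≡ 7 (8)` with `−ℓ` Heegner for `N_W`, `ℓ` an IDENTITY prime (`Frob_ℓ` trivial on `E[2]`), and the localisation at `ℓ` INJECTIVE on the
∞-relaxed Selmer group `Sel₂^{rel ∞}(W) = {0, x, y, x + y}`.  gk2-p4's MAZUR–RUBIN TWISTING PRIMES (`GenusKolyTwistingPrime.exists_twistingPrime`, `Δ < 0`,
ONE class, Frobenius = complex conjugation `c₀` = a transposition, non-triviality of `x_ℓ` read off `[x, Frob²]`) do not apply: on `Δ > 0` the conjugation
`c₀` FIXES `E[2]` (`GenusKolySign.twoTorsion_smul_eq_of_Δ_pos`), so a Frobenius in `c₀ · Γ_{ℚ(E[2])}` is an identity prime, `[x, Frob²] = 2[x, Frob] = 0`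
carries no information, and TWO classes must be controlled at once.  This file supplies the two missing pieces and runs the same Čebotarev argument:

* (§1, the easy half of the local criterion for a Frobenius `γ ∈ Γ_{K(E[n])}` ITSELF, `[x, γ] ≠ 0 ⟹ x_v ≠ 0`, is ALREADY in the tree:
  `GenusKolyLowering.not_mem_torsionLocalKer_of_h1Eval_frob_ne_zero`, file `…GenusPrimitiveSupplyAtTwoLoweringPrime`; the sequel cites it.)
* §2 `exists_torsionFixing_fix_h1Eval_ne_zero` (one class: some `h ∈ Γ_{ℚ(E[2], ζ)}` has `[x, h] ≠ 0`; Gross Prop. 9.1 at `2` + commutators) and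
  **`exists_torsionFixing_fix_h1Eval_eq_pair`** — THE TWO-CLASS KEY LEMMA: for `ρ̄_{W,2}` onto and `x, y, x + y ≠ 0`, the map `h ↦ ([x,h], [y,h])` on
  `Γ_{ℚ(E[2], ζ)}` is ONTO `E[2] × E[2]` (its image is an additive, `Γ_ℚ`-stable subgroup of `E[2]²` not contained in `E[2] × 0`, `0 × E[2]` or the diagonal;
  the `GL₂(𝔽₂)`-stable subgroups of `𝔽₂² ⊕ 𝔽₂²` are `0`, the three copies of `𝔽₂²`, and everything — realised here with a transvection from `ρ̄` onto and
  transitivity on `E[2] ∖ 0`).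
* §3 **`exists_identityPrime_pair`** — for `W/ℚ` elliptic with `Δ_W > 0`, `ρ̄_{W,2}` onto, a complex conjugation `c₀`, `x, y ∈ H¹(ℚ, E[2])` with `x, y, x + y ≠ 0`,
  `m ≥ 1`, `b`: a prime `ℓ > b`, `ℓ ∤ m`, `m ∣ ℓ + 1`, an arithmetic Frobenius at `ℓ` acting on `E[2]` as `c₀`, i.e. TRIVIALLY, and
  `x, y, x + y ∉ ker (H¹(ℚ, E[2]) → H¹(ℚ_ℓ, E[2]))`.  Proof: §2 gives `h₀ ∈ Γ_{ℚ(E[2], μ_m)}` with `[x, h₀] = a − [x, c₀]`, `[y, h₀] = z a − [y, c₀]` for a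
  non-zero `a ∈ E[2]` and an element `z` of order `3`; Čebotarev puts a Frobenius `γ` in the open set `c₀ h₀ · (𝒩_{x,y} ∩ Stab μ_m)`; `γ` inverts `μ_m` so
  `m ∣ ℓ + 1`; `γ ∈ Γ_{ℚ(E[2])}` with `[x, γ] = a`, `[y, γ] = z a`, `[x + y, γ] = a + z a`, all non-zero; §1.
* §4 `exists_identityPrime_pair_not_mem_strictLocalKer` — the same in the line's currency (`ℓ ≡ 7 (mod 8)`, `p ∣ N → p ∣ ℓ + 1`, `ℓ ∤ 2N`,
  `MazurRubin2010.strictLocalKer`).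

References: [MazurRubin2010] Prop. 3.3, Lemma 3.5 (twisting primes via Čebotarev); [GrossLMS1991] §9 Prop. 9.1, 9.6; [McCallumLMS1991] §3; [Kramer1981] Prop. 3;
[SerreAbelianLadic1968] I §2.2; [LawsonWuthrich2016] Lemma 6.
-/

set_option linter.dupNamespace false -- tree convention: `Summit.BirchSwinnertonDyer.BirchSwinnertonDyer.Theorems` (summit = sub-problem)
set_option autoImplicit false

noncomputable section

open scoped Classical Pointwise

namespace Summit.BirchSwinnertonDyer.BirchSwinnertonDyer.Theorems.GenusExact.TwinSwap.IdentityDoor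

open WeierstrassCurve NumberField IsDedekindDomain Field
open Literature.NumberTheory.GaloisRepresentations Literature.NumberTheory.EllipticCurves
open Literature.NumberTheory
open Summit.BirchSwinnertonDyer.BirchSwinnertonDyer.Theorems.GenusKolyTwistingPrime

/-! ## §2 The key lemmas over `ℚ` at level `2`: one class, then two classes -/

section KeyLemma

variable (W : WeierstrassCurve ℚ) [W.IsElliptic]

/-- **One class** (Step 1 of gk2-p4's key lemma, sign-free): for `x ≠ 0` in `H¹(ℚ, E[2])` (`ρ̄_{W,2}` onto) and a root of unity `ζ`, some `h ∈ Γ_{ℚ(E[2])}` fixing `ζ`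
has `[x, h] ≠ 0` — else every `[x, ρ]`, `ρ ∈ Γ_{ℚ(E[2])}`, is `Γ_ℚ`-fixed (commutators lie in `Γ_{ℚ(E[2], ζ)}`), hence `0`, hence `x = 0` by Gross's Prop. 9.1 at `2`.
[cite: GrossLMS1991, §9 Prop. 9.1] [cite: MazurRubin2010, Lemma 3.5] -/
theorem exists_torsionFixing_fix_h1Eval_ne_zero (hsurj : W.HasSurjectiveModNGaloisRep 2)
    {x : galH1Torsion W (2 : ℤ)} (hx : x ≠ 0) {m : ℕ} [NeZero m] {ζ : AlgebraicClosure ℚ} (hζ : IsPrimitiveRoot ζ m) :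
    ∃ h ∈ torsionFixing W (2 : ℤ), h • ζ = ζ ∧ h1Eval W (2 : ℤ) x h ≠ 0 := by
  by_contra hcon
  push Not at hcon
  apply hx
  apply h1_restriction_injective_two_rat W hsurj
  intro ρ hρ
  apply eq_zero_of_forall_smul_eq W hsurj
  intro γ
  have hc1 : γ * ρ * γ⁻¹ ∈ torsionFixing W (2 : ℤ) := (torsionFixing_normal W _).conj_mem ρ hρ γ
  have hcomm_fix : γ * ρ * γ⁻¹ * ρ⁻¹ ∈ torsionFixing W (2 : ℤ) := mul_mem hc1 (inv_mem hρ)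
  have hcomm_ζ : (γ * ρ * γ⁻¹ * ρ⁻¹) • ζ = ζ := commutator_smul_rootOfUnity hζ γ ρ
  have h0 := hcon _ hcomm_fix hcomm_ζ
  rw [h1Eval_mul W _ x hc1, h1Eval_conj W _ x γ hρ, h1Eval_inv W _ x hρ, add_neg_eq_zero] at h0
  exact h0

/-- The coordinate swap on `𝔽₂²` fixes `0` and `(1,1)` and moves every other vector `s` to `s + (1,1)` (a transvection). [folklore] -/
theorem swap_cases_fin_two : ∀ s : Fin 2 → ZMod 2, s = 0 ∨ s = (fun _ ↦ 1) ∨ (s ∘ Equiv.swap (0 : Fin 2) 1) = s + fun _ ↦ 1 := by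
  decide

/-- **THE TWO-CLASS KEY LEMMA.**  For `W/ℚ` with `ρ̄_{W,2}` onto, classes `x, y ∈ H¹(ℚ, E[2])` with `x ≠ 0`, `y ≠ 0`, `x ≠ y`, and a root of unity `ζ`: for EVERY
pair `(a, b) ∈ E[2] × E[2]` some `h ∈ Γ_{ℚ(E[2])}` fixing `ζ` has `[x, h] = a` and `[y, h] = b`.  The set of attained pairs is an additive subgroup of `E[2]²`
(`[·, hh'] = [·, h] + [·, h']` on `Γ_{ℚ(E[2])}`) stable under the diagonal action of `Γ_ℚ` (`[·, σhσ⁻¹] = σ[·, h]`), not inside `E[2] × 0`, `0 × E[2]` or the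
diagonal (one-class lemma for `y`, `x`, `x + y`); with `ρ̄` onto `Aut E[2] ≅ S₃` (a transvection and transitivity on `E[2] ∖ 0`) such a subgroup is everything.
[cite: MazurRubin2010, Lemma 3.5] [cite: GrossLMS1991, §9 Prop. 9.1] [cite: Serre1972, §2.1] -/
theorem exists_torsionFixing_fix_h1Eval_eq_pair (hsurj : W.HasSurjectiveModNGaloisRep 2)
    {x y : galH1Torsion W (2 : ℤ)} (hx : x ≠ 0) (hy : y ≠ 0) (hxy : x ≠ y)
    {m : ℕ} [NeZero m] {ζ : AlgebraicClosure ℚ} (hζ : IsPrimitiveRoot ζ m) (a b : geomTorsion W (2 : ℤ)) :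
    ∃ h ∈ torsionFixing W (2 : ℤ), h • ζ = ζ ∧ h1Eval W (2 : ℤ) x h = a ∧ h1Eval W (2 : ℤ) y h = b := by
  -- ### the attained pairs
  set Good : geomTorsion W (2 : ℤ) → geomTorsion W (2 : ℤ) → Prop := fun a b ↦
    ∃ h ∈ torsionFixing W (2 : ℤ), h • ζ = ζ ∧ h1Eval W (2 : ℤ) x h = a ∧ h1Eval W (2 : ℤ) y h = b with hGood
  change Good a b
  -- elementary facts on `V = E[2]`
  have hV2 : ∀ v : geomTorsion W (2 : ℤ), v + v = 0 := fun v ↦ by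
    rw [← two_nsmul]; exact AddSubgroup.torsionBy.nsmul v
  have hneg : ∀ v : geomTorsion W (2 : ℤ), -v = v := fun v ↦ by
    rw [neg_eq_iff_add_eq_zero, hV2]
  have hsub : ∀ v w : geomTorsion W (2 : ℤ), v - w = v + w := fun v w ↦ by rw [sub_eq_add_neg, hneg]
  -- conjugates of `ζ`-fixing elements fix `ζ`
  have hpow : ∀ σ : absoluteGaloisGroup ℚ, ∃ i : ℕ, σ • ζ = ζ ^ i := fun σ ↦ by
    have h1 : (σ • ζ) ^ m = 1 := by rw [← smul_pow', hζ.pow_eq_one, smul_one]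
    obtain ⟨i, -, hi⟩ := hζ.eq_pow_of_pow_eq_one h1
    exact ⟨i, hi.symm⟩
  have hconj : ∀ σ h : absoluteGaloisGroup ℚ, h • ζ = ζ → (σ * h * σ⁻¹) • ζ = ζ := by
    intro σ h hh
    obtain ⟨i, hi⟩ := hpow σ⁻¹
    rw [mul_smul, mul_smul, hi, smul_pow', hh, ← hi, smul_inv_smul]
  -- (G0) (Gadd) (Gsmul)
  have G0 : Good 0 0 := ⟨1, one_mem _, one_smul _ _, h1Eval_one W _ x, h1Eval_one W _ y⟩
  have Gadd : ∀ {a b a' b'}, Good a b → Good a' b' → Good (a + a') (b + b') := by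
    rintro a b a' b' ⟨h, hh, hζh, rfl, rfl⟩ ⟨h', hh', hζh', rfl, rfl⟩
    exact ⟨h * h', mul_mem hh hh', by rw [mul_smul, hζh', hζh], h1Eval_mul W _ x hh h', h1Eval_mul W _ y hh h'⟩
  have Gsmul : ∀ (σ : absoluteGaloisGroup ℚ) {a b}, Good a b → Good (σ • a) (σ • b) := by
    rintro σ a b ⟨h, hh, hζh, rfl, rfl⟩
    exact ⟨σ * h * σ⁻¹, (torsionFixing_normal W _).conj_mem h hh σ, hconj σ h hζh, h1Eval_conj W _ x σ hh, h1Eval_conj W _ y σ hh⟩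
  -- the three witnesses
  obtain ⟨h₁, hh₁, hζ₁, hv₁⟩ := exists_torsionFixing_fix_h1Eval_ne_zero W hsurj hx hζ
  obtain ⟨h₂, hh₂, hζ₂, hv₂⟩ := exists_torsionFixing_fix_h1Eval_ne_zero W hsurj hy hζ
  have hT : ∀ P : geomTorsion W (2 : ℤ), 2 • P = 0 := fun P ↦ AddSubgroup.torsionBy.nsmul P
  have hxy' : x + y ≠ 0 := fun h0 ↦ hxy (by
    have := eq_neg_of_add_eq_zero_left h0
    rw [this]
    -- `-y = y` in `H¹(ℚ, E[2])`: `2y = 0`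
    have h2 : y + y = 0 := by
      rw [← two_nsmul]
      exact galoisCohomology.nsmul_eq_zero_of_forall (W.torsionGaloisModule (2 : ℤ)) hT y
    exact (neg_eq_iff_add_eq_zero.mpr h2))
  obtain ⟨h₃, hh₃, hζ₃, hv₃⟩ := exists_torsionFixing_fix_h1Eval_ne_zero W hsurj hxy' hζ
  have W1 : Good (h1Eval W _ x h₁) (h1Eval W _ y h₁) := ⟨h₁, hh₁, hζ₁, rfl, rfl⟩
  have W2 : Good (h1Eval W _ x h₂) (h1Eval W _ y h₂) := ⟨h₂, hh₂, hζ₂, rfl, rfl⟩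
  have W3 : Good (h1Eval W _ x h₃) (h1Eval W _ y h₃) := ⟨h₃, hh₃, hζ₃, rfl, rfl⟩
  have hv₃' : h1Eval W _ x h₃ ≠ h1Eval W _ y h₃ := by
    intro heq
    apply hv₃
    rw [h1Eval_add W _ x y hh₃, heq, hV2]
  -- transitivity on `E[2] ∖ 0`
  have hsurj' : W.HasSurjectiveModNGaloisRep ((2 : ℕ) : ℤ) := by simpa using hsurj
  have h2Q : ((2 : ℕ) : ℚ) ≠ 0 := by norm_num
  have T1 : ∀ {p q : geomTorsion W (2 : ℤ)}, p ≠ 0 → q ≠ 0 → ∃ σ : absoluteGaloisGroup ℚ, σ • p = q :=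
    fun hp hq ↦ exists_smul_eq_of_hasSurjectiveModNGaloisRep W 2 h2Q hsurj' hp hq
  -- an element of order `3` with no non-zero fixed point
  obtain ⟨z, -, hzfix⟩ := exists_smul_three_rat W hsurj
  have hz0 : ∀ {p : geomTorsion W (2 : ℤ)}, p ≠ 0 → z • p ≠ 0 := fun hp h ↦ hp ((smul_eq_zero_iff_eq z).mp h)
  have hzne : ∀ {p : geomTorsion W (2 : ℤ)}, p ≠ 0 → z • p ≠ p := fun hp h ↦ hp (hzfix _ h)
  -- (A) a column `0 × (E[2] ∖ 0)` and a row `(E[2] ∖ 0) × 0` propagate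
  have colAll : ∀ {b₀}, b₀ ≠ 0 → Good 0 b₀ → ∀ w, Good 0 w := by
    intro b₀ hb₀ hG w
    by_cases hw : w = 0
    · rw [hw]; exact G0
    · obtain ⟨σ, hσ⟩ := T1 hb₀ hw
      have := Gsmul σ hG
      rwa [smul_zero, hσ] at this
  have rowAll : ∀ {a₀}, a₀ ≠ 0 → Good a₀ 0 → ∀ w, Good w 0 := by
    intro a₀ ha₀ hG w
    by_cases hw : w = 0
    · rw [hw]; exact G0
    · obtain ⟨σ, hσ⟩ := T1 ha₀ hw
      have := Gsmul σ hG
      rwa [smul_zero, hσ] at this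
  -- (B) a transvection: `γ₀` fixing `f ≠ 0` and moving every `t ∉ {0, f}` to `t + f`
  haveI : Fact (Nat.Prime 2) := ⟨Nat.prime_two⟩
  obtain ⟨eT⟩ := KolyvaginImage.nonempty_addEquiv_of_card_eq_sq hT (natCard_geomTorsion_two_rat W)
  let τ' : (Fin 2 → ZMod 2) ≃+ (Fin 2 → ZMod 2) :=
    { toFun := fun s ↦ s ∘ Equiv.swap (0 : Fin 2) 1
      invFun := fun s ↦ s ∘ Equiv.swap (0 : Fin 2) 1
      left_inv := fun s ↦ by ext i; simp [Equiv.swap_apply_self]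
      right_inv := fun s ↦ by ext i; simp [Equiv.swap_apply_self]
      map_add' := fun _ _ ↦ rfl }
  have hτ'all : ∀ s : Fin 2 → ZMod 2, s = 0 ∨ s = (fun _ ↦ 1) ∨ τ' s = s + fun _ ↦ 1 := swap_cases_fin_two
  have hτ'one : τ' (fun _ ↦ 1) = fun _ ↦ 1 := rfl
  let A : geomTorsion W (2 : ℤ) ≃+ geomTorsion W (2 : ℤ) := eT.trans (τ'.trans eT.symm)
  obtain ⟨γ₀, hγ₀⟩ := hsurj (Multiplicative.ofAdd A)
  have hγ₀A : ∀ P : geomTorsion W (2 : ℤ), γ₀ • P = A P := fun P ↦ by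
    have h := galoisRepTorsion_apply W (2 : ℤ) γ₀ P
    rw [hγ₀, toAdd_ofAdd] at h
    exact h.symm
  set f : geomTorsion W (2 : ℤ) := eT.symm (fun _ ↦ 1) with hfdef
  have hf0 : f ≠ 0 := by
    intro h
    have h' : (fun _ : Fin 2 ↦ (1 : ZMod 2)) = 0 := eT.symm.injective (by rw [← hfdef, h, map_zero])
    have h10 : (1 : ZMod 2) = 0 := by simpa using congrFun h' 0
    haveI : Fact (1 < 2) := ⟨by norm_num⟩
    exact absurd h10 one_ne_zero
  have hγ₀f : γ₀ • f = f := by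
    rw [hγ₀A]
    change eT.symm (τ' (eT (eT.symm (fun _ ↦ 1)))) = eT.symm (fun _ ↦ 1)
    rw [eT.apply_symm_apply, hτ'one]
  have hγ₀t : ∀ t : geomTorsion W (2 : ℤ), t ≠ 0 → t ≠ f → γ₀ • t = t + f := by
    intro t ht0 htf
    rw [hγ₀A]
    change eT.symm (τ' (eT t)) = t + eT.symm (fun _ ↦ 1)
    rcases hτ'all (eT t) with h | h | h
    · exact absurd (eT.injective (h.trans (map_zero eT).symm)) ht0
    · have htf' : t = f := by rw [hfdef, ← h, eT.symm_apply_apply]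
      exact absurd htf' htf
    · rw [h, map_add, eT.symm_apply_apply]
  -- (C) from a pair `(a, b)` with `a, b ≠ 0`, `a ≠ b`: everything
  have keyC : ∀ {a b}, a ≠ 0 → b ≠ 0 → a ≠ b → Good a b → ∀ a' b', Good a' b' := by
    intro a b ha hb hab hG a' b'
    obtain ⟨ρ, hρ⟩ := T1 ha hf0
    have hG1 : Good f (ρ • b) := by have := Gsmul ρ hG; rwa [hρ] at this
    have hρb0 : ρ • b ≠ 0 := fun h ↦ hb ((smul_eq_zero_iff_eq ρ).mp h)
    have hρbf : ρ • b ≠ f := fun h ↦ hab (smul_left_cancel ρ (hρ.trans h.symm))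
    have hG2 : Good f (ρ • b + f) := by
      have := Gsmul γ₀ hG1
      rwa [hγ₀f, hγ₀t _ hρb0 hρbf] at this
    have hG3 : Good 0 f := by
      have := Gadd hG1 hG2
      rwa [hV2, ← add_assoc, hV2, zero_add] at this
    have hcol := colAll hf0 hG3
    have hG4 : Good f 0 := by
      have := Gadd hG1 (hcol (ρ • b))
      rwa [add_zero, hV2] at this
    have hrow := rowAll hf0 hG4
    have := Gadd (hrow a') (hcol b')
    rwa [add_zero, zero_add] at this
  -- (D) produce such a pair from the three witnesses
  by_cases h3a : h1Eval W _ x h₃ = 0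
  · -- witness 3 is `(0, b₃)` with `b₃ ≠ 0`: the column, then witness 1 `(a₁, b₁)` with `a₁ ≠ 0`
    have hb₃ : h1Eval W _ y h₃ ≠ 0 := fun h ↦ hv₃' (h3a.trans h.symm)
    have hcol := colAll hb₃ (by rw [← h3a]; exact W3)
    set a₁ := h1Eval W _ x h₁
    set b₁ := h1Eval W _ y h₁
    have hG : Good a₁ (z • a₁) := by
      have := Gadd W1 (hcol (b₁ + z • a₁))
      rwa [add_zero, ← add_assoc, hV2, zero_add] at this
    exact keyC hv₁ (hz0 hv₁) (hzne hv₁).symm hG a b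
  · by_cases h3b : h1Eval W _ y h₃ = 0
    · -- witness 3 is `(a₃, 0)` with `a₃ ≠ 0`: the row, then witness 2 `(a₂, b₂)` with `b₂ ≠ 0`
      have hrow := rowAll h3a (by rw [← h3b]; exact W3)
      set a₂ := h1Eval W _ x h₂
      set b₂ := h1Eval W _ y h₂
      have hG : Good (z • b₂) b₂ := by
        have := Gadd W2 (hrow (a₂ + z • b₂))
        rwa [add_zero, ← add_assoc, hV2, zero_add] at this
      exact keyC (hz0 hv₂) hv₂ (hzne hv₂) hG a b
    · exact keyC h3a h3b hv₃' W3 a b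

end KeyLemma

end Summit.BirchSwinnertonDyer.BirchSwinnertonDyer.Theorems.GenusExact.TwinSwap.IdentityDoor

end
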